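import Mathlib
import Summits.Ventures.PercRepro2.ZMeanProof

/-!
# The mean field is affine in the weight of any edge at `a₃` (blind cell PercRepro2, night-1 g17;
NIGHT1-G17.md §4)

The residual shares of a cluster row `W` (`delShareMass`, `delConnProb`, the residual `delQ`) are
probabilities of events determined by the edges not touching `W` (`dependsOn_connDelEvent`): they
are INSENSITIVE to pinning an edge that touches `W` (`prob_update_one_eq_of_invariant`,
`prob_update_zero_eq_of_invariant`).
Every cluster of `a₃` contains `a₃`, so for an edge `f` at `a₃` the row terms `termW` do not move
with `p f`, and the pinning identity of the row probabilities gives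

* **`Xhat_eq_pin`**: `X̂(p) = p f · X̂(p[f ↦ 1]) + (1 − p f) · X̂(p[f ↦ 0])` for every edge `f ∋ a₃`

— the generalisation of the leaf case (`A3Leaf.Xhat_update_mix`) to an arbitrary edge at `a₃`;
hence the cleared mean field `HMFc` is a polynomial of degree ≤ 3 in the weight of any edge at
`a₃`.  Own code; standard axioms.
-/

open scoped Classical

namespace Summit.Ventures.PercRepro2

open UnionCluster CovForm

namespace XhatPin

section Invariant

variable {E : Type*} [Fintype E] [DecidableEq E] {R : Type*} [CommRing R]

/-- Pinning an edge open does not change the probability of an event insensitive to that edge. -/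
lemma prob_update_one_eq_of_invariant (p : E → R) (A : Set (Config E)) (e : E)
    (hA : ∀ ω, Function.update ω e true ∈ A ↔ ω ∈ A) :
    prob (Function.update p e 1) A = prob p A := by
  rw [prob_eq_expect_indicator, prob_eq_expect_indicator, expect_update_one]
  unfold expect
  refine Finset.sum_congr rfl fun ω _ => ?_
  congr 1
  show A.indicator (1 : Config E → R) (Function.update ω e true) = A.indicator 1 ω
  by_cases h : ω ∈ A
  · rw [Set.indicator_of_mem h, Set.indicator_of_mem ((hA ω).2 h)]; rfl
  · rw [Set.indicator_of_notMem h, Set.indicator_of_notMem (fun h' => h ((hA ω).1 h'))]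

/-- Pinning an edge closed does not change the probability of an event insensitive to that edge. -/
lemma prob_update_zero_eq_of_invariant (p : E → R) (A : Set (Config E)) (e : E)
    (hA : ∀ ω, Function.update ω e false ∈ A ↔ ω ∈ A) :
    prob (Function.update p e 0) A = prob p A := by
  rw [prob_eq_expect_indicator, prob_eq_expect_indicator, expect_update_zero]
  unfold expect
  refine Finset.sum_congr rfl fun ω _ => ?_
  congr 1
  show A.indicator (1 : Config E → R) (Function.update ω e false) = A.indicator 1 ω
  by_cases h : ω ∈ A
  · rw [Set.indicator_of_mem h, Set.indicator_of_mem ((hA ω).2 h)]; rfl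
  · rw [Set.indicator_of_notMem h, Set.indicator_of_notMem (fun h' => h ((hA ω).1 h'))]

end Invariant

section Rows

variable {V : Type*} {E : Type*} [Fintype E] [DecidableEq E] [Fintype V] [DecidableEq V]
  {R : Type*} [Field R] [LinearOrder R] [IsStrictOrderedRing R]

variable (p : E → R) (ends : E → Sym2 V) {W : Finset V} {f : E}

omit [Fintype E] [LinearOrder R] [IsStrictOrderedRing R] in
/-- The residual connection event is insensitive to an edge touching `W`. -/
lemma connDelEvent_update_iff (hfW : f ∈ touches ends ↑W) (u w : V) (ω : Config E) (c : Bool) :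
    Function.update ω f c ∈ connDelEvent ends W u w ↔ ω ∈ connDelEvent ends W u w := by
  refine dependsOn_mem_iff (dependsOn_connDelEvent ends W u w) fun e' he' => ?_
  have hne : e' ≠ f := by
    intro h
    subst h
    exact he' hfW
  rw [Function.update_of_ne hne]

omit [Fintype E] [LinearOrder R] [IsStrictOrderedRing R] in
/-- The residual disconnection event is insensitive to an edge touching `W`. -/
lemma delQ_update_iff (hfW : f ∈ touches ends ↑W) (a₁ a₂ : V) (ω : Config E) (c : Bool) :
    Function.update ω f c ∈ delQ ends W a₁ a₂ ↔ ω ∈ delQ ends W a₁ a₂ := by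
  simp only [delQ, Set.mem_compl_iff]
  rw [connDelEvent_update_iff ends hfW]

omit [LinearOrder R] [IsStrictOrderedRing R] in
/-- `delConnProb` does not move with the weight of an edge touching `W` (pinned open). -/
lemma delConnProb_update_one (hfW : f ∈ touches ends ↑W) (x v : V) :
    delConnProb (Function.update p f 1) ends W x v = delConnProb p ends W x v := by
  unfold delConnProb
  split_ifs with h
  · rfl
  · exact prob_update_one_eq_of_invariant p _ f fun ω => connDelEvent_update_iff ends hfW x v ω true

omit [LinearOrder R] [IsStrictOrderedRing R] in
/-- `delConnProb` does not move with the weight of an edge touching `W` (pinned closed). -/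
lemma delConnProb_update_zero (hfW : f ∈ touches ends ↑W) (x v : V) :
    delConnProb (Function.update p f 0) ends W x v = delConnProb p ends W x v := by
  unfold delConnProb
  split_ifs with h
  · rfl
  · exact prob_update_zero_eq_of_invariant p _ f fun ω =>
      connDelEvent_update_iff ends hfW x v ω false

omit [LinearOrder R] [IsStrictOrderedRing R] in
/-- `delShareMass` does not move with the weight of an edge touching `W` (pinned open). -/
lemma delShareMass_update_one (hfW : f ∈ touches ends ↑W) (a₁ a₂ x v : V) :
    delShareMass (Function.update p f 1) ends W a₁ a₂ x v = delShareMass p ends W a₁ a₂ x v := by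
  unfold delShareMass
  split_ifs with h
  · rfl
  · refine prob_update_one_eq_of_invariant p _ f fun ω => ?_
    simp only [Set.mem_inter_iff]
    rw [delQ_update_iff ends hfW, connDelEvent_update_iff ends hfW]

omit [LinearOrder R] [IsStrictOrderedRing R] in
/-- `delShareMass` does not move with the weight of an edge touching `W` (pinned closed). -/
lemma delShareMass_update_zero (hfW : f ∈ touches ends ↑W) (a₁ a₂ x v : V) :
    delShareMass (Function.update p f 0) ends W a₁ a₂ x v = delShareMass p ends W a₁ a₂ x v := by
  unfold delShareMass
  split_ifs with h
  · rfl
  · refine prob_update_zero_eq_of_invariant p _ f fun ω => ?_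
    simp only [Set.mem_inter_iff]
    rw [delQ_update_iff ends hfW, connDelEvent_update_iff ends hfW]

omit [LinearOrder R] [IsStrictOrderedRing R] in
/-- The residual `P(Q_W)` does not move with the weight of an edge touching `W` (pinned open). -/
lemma prob_delQ_update_one (hfW : f ∈ touches ends ↑W) (a₁ a₂ : V) :
    prob (Function.update p f 1) (delQ ends W a₁ a₂) = prob p (delQ ends W a₁ a₂) :=
  prob_update_one_eq_of_invariant p _ f fun ω => delQ_update_iff ends hfW a₁ a₂ ω true

omit [LinearOrder R] [IsStrictOrderedRing R] in
/-- The residual `P(Q_W)` does not move with the weight of an edge touching `W` (pinned closed). -/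
lemma prob_delQ_update_zero (hfW : f ∈ touches ends ↑W) (a₁ a₂ : V) :
    prob (Function.update p f 0) (delQ ends W a₁ a₂) = prob p (delQ ends W a₁ a₂) :=
  prob_update_zero_eq_of_invariant p _ f fun ω => delQ_update_iff ends hfW a₁ a₂ ω false

omit [LinearOrder R] [IsStrictOrderedRing R] in
/-- The row term `termW` does not move with the weight of an edge touching `W` (pinned open). -/
lemma termW_update_one (hfW : f ∈ touches ends ↑W) (o a₁ a₂ b : V) :
    termW (Function.update p f 1) ends o a₁ a₂ b W = termW p ends o a₁ a₂ b W := by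
  simp only [termW, termT, termPD, delConnProb_update_one p ends hfW,
    delShareMass_update_one p ends hfW, prob_delQ_update_one p ends hfW]

omit [LinearOrder R] [IsStrictOrderedRing R] in
/-- The row term `termW` does not move with the weight of an edge touching `W` (pinned closed). -/
lemma termW_update_zero (hfW : f ∈ touches ends ↑W) (o a₁ a₂ b : V) :
    termW (Function.update p f 0) ends o a₁ a₂ b W = termW p ends o a₁ a₂ b W := by
  simp only [termW, termT, termPD, delConnProb_update_zero p ends hfW,
    delShareMass_update_zero p ends hfW, prob_delQ_update_zero p ends hfW]

omit [Fintype E] [DecidableEq E] [Fintype V] [DecidableEq V] [LinearOrder R] [IsStrictOrderedRing R] in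
/-- A row not containing `a₃` is not a cluster of `a₃`. -/
lemma clusterEvent_eq_empty_of_notMem {a₃ : V} (h : a₃ ∉ W) :
    clusterEvent ends a₃ (↑W : Set V) = ∅ := by
  ext ω
  simp only [mem_clusterEvent, Set.mem_empty_iff_false, iff_false]
  intro hW
  exact h (Finset.mem_coe.1 (hW ▸ mem_cluster_self ends ω a₃))

end Rows

section Pin

variable {V : Type*} {E : Type*} [Fintype E] [DecidableEq E] [Fintype V] [DecidableEq V]
  {R : Type*} [Field R] [LinearOrder R] [IsStrictOrderedRing R]

variable (p : E → R) (ends : E → Sym2 V) (o a₁ a₂ a₃ b : V) {f : E}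

omit [LinearOrder R] [IsStrictOrderedRing R] in
/-- **The mean field is affine in the weight of any edge at `a₃`**:
`X̂(p) = p f · X̂(p[f ↦ 1]) + (1 − p f) · X̂(p[f ↦ 0])`. -/
theorem Xhat_eq_pin (hf : a₃ ∈ ends f) :
    Xhat p ends o a₁ a₂ a₃ b =
      p f * Xhat (Function.update p f 1) ends o a₁ a₂ a₃ b +
        (1 - p f) * Xhat (Function.update p f 0) ends o a₁ a₂ a₃ b := by
  simp only [Xhat_eq_sum, Finset.mul_sum, ← Finset.sum_add_distrib]
  refine Finset.sum_congr rfl fun W _ => ?_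
  by_cases hW : a₃ ∈ W
  · have hfW : f ∈ touches ends ↑W := by
      obtain ⟨y, hy⟩ := Sym2.mem_iff_exists.1 hf
      exact mem_touches_of_ends hy (Or.inl (Finset.mem_coe.2 hW))
    rw [termW_update_one p ends hfW, termW_update_zero p ends hfW,
      prob_eq_pin p (clusterEvent ends a₃ (↑W : Set V)) f]
    ring
  · rw [clusterEvent_eq_empty_of_notMem ends hW]
    simp only [prob_empty, zero_mul, mul_zero, add_zero]

end Pin

end XhatPin

end Summit.Ventures.PercRepro2
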